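import Literature.Geometry.DiscreteGeometry.SphericalCapKernel
import HarnessLib

/-!
# Cap-cut certificates: inequality (II) on the printed half-domain `u ≤ v`

Venture `Crystal3D` (cell `pub-crystal3d`, phase 2; seat p3). The kernel of a cap certificate
(`Literature.Geometry.DiscreteGeometry.BachocVallentin.CapCert.kernel`) is symmetric in `(u, v)`, so its
inequality (II) — stated in the tree on the full box `[u₀,1]²` — follows from the same inequality on
Bachoc–Vallentin's printed domain `Δ = {u₀ ≤ u ≤ v ≤ 1, -1 ≤ t ≤ s, 1 + 2uvt - u² - v² - t² ≥ 0}`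
[BachocVallentin2009, §3]. This halves the work of any checker of (II) (the cell's exact checkers use the
symmetry; a future kernel replay would too). Nothing else is here.
-/

open Finset
open Literature.Geometry.DiscreteGeometry.BachocVallentin

namespace Summit.Ventures.Crystal3D.CapCut

/-- The zonal factor is symmetric in `(u, v)`. [cite: BachocVallentin2009, Theorem 2.1] -/
theorem Q3_swap (k : ℕ) (u v t : ℝ) : Q3 k u v t = Q3 k v u t := by
  unfold Q3; rw [mul_comm u v, mul_comm (1 - u ^ 2)]

/-- A certificate's kernel is symmetric in `(u, v)`: `K(u,v,t) = K(v,u,t)`.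
[cite: BachocVallentin2009, Lemma 4.1 (F(u,v,t) = F(v,u,t))] -/
theorem kernel_swap (c : CapCert) (u v t : ℝ) : c.kernel u v t = c.kernel v u t := by
  unfold CapCert.kernel capKernel3
  refine Finset.sum_congr rfl fun k _ => Finset.sum_congr rfl fun r _ => ?_
  rw [Q3_swap]; ring

/-- **(II) from the printed half-domain**: if `K(u,v,t) ≤ -λ` for `u₀ ≤ u ≤ v ≤ 1`, `-1 ≤ t ≤ s`,
`1 + 2uvt - u² - v² - t² ≥ 0`, then `c.IneqII s λ` (the full box). [cite: BachocVallentin2009, §3 (Δ)] -/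
theorem ineqII_of_half (c : CapCert) (s lam : ℚ)
    (h : ∀ u v t : ℝ, (c.u0 : ℝ) ≤ u → u ≤ v → v ≤ 1 → -1 ≤ t → t ≤ s →
      0 ≤ 1 + 2 * u * v * t - u ^ 2 - v ^ 2 - t ^ 2 → c.kernel u v t ≤ -lam) :
    c.IneqII s lam := by
  intro u v t hu0 hu1 hv0 hv1 ht1 hts hg
  rcases le_total u v with huv | hvu
  · exact h u v t hu0 huv hv1 ht1 hts hg
  · rw [kernel_swap]
    exact h v u t hv0 hvu hu1 ht1 hts (by linarith [hg])

end Summit.Ventures.Crystal3D.CapCut
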